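import Summits.RiemannHypothesis.RiemannHypothesis.Theorems.WeilTwoPrimeDeflC83XBase
import Summits.RiemannHypothesis.RiemannHypothesis.Theorems.WeilTwoPrimeDeflC83XDataPO30
import Literature.NumberTheory.LFunctions.WeilBlockRowsPZ
import Literature.NumberTheory.LFunctions.WeilBlockRowsFast
import Summits.RiemannHypothesis.RiemannHypothesis.Theorems.WeilLegendreBlocks136DataDn14
import HarnessLib

/-!
# Deflated two-prime certificate C83X: dominance of rows 36–36 of `R = S''_odd(κ') − UᵀU` (factored data)

`WeilCert.checkDomRowPZ` with the materialized augmented block, the factored inverse `weilBlocks136Dn/weilBlocks136Ls` and the Bessel block, by `decide +kernel` row by row. Pure proof file.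
-/

set_option linter.dupNamespace false

noncomputable section

namespace Summit.RiemannHypothesis.RiemannHypothesis.Theorems.EvenWinsBeyondArch

open Literature.NumberTheory.LFunctions

set_option maxHeartbeats 0 in
/-- Kernel check of the dominance of row 36 of `R` (odd block, certificate C83X). [folklore] -/
theorem checkDomRowF1_36_weilCertDeflC83X :
    weilCertDeflC83XBase.checkDomRowF weilCertDeflC83XPmO weilBlocks136Dn weilBlocks136Ls weilCertDeflC83XHpO weilCertDeflC83XKappa' 1 36 = true := by
  decide +kernel

/-- Kernel check of the dominance of row 36 of `R` (factored data), from the fast row. [folklore] -/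
theorem checkDomRowPZ1_36_weilCertDeflC83X :
    weilCertDeflC83XBase.checkDomRowPZ weilCertDeflC83XPmO weilBlocks136Dn weilBlocks136Ls weilCertDeflC83XHpO weilCertDeflC83XKappa' 1 36 = true :=
  WeilCert.checkDomRowPZ_of_F (by decide) checkDomRowF1_36_weilCertDeflC83X


end Summit.RiemannHypothesis.RiemannHypothesis.Theorems.EvenWinsBeyondArch
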